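import Summits.KontsevichZagierPeriods.Zeta5Search.Certificates.RecordRayCentreValue
import HarnessLib

/-!
# ζ(5) search — certificates: asymptotic form of the centre value on the record ray (`Y ∈ [3n, 3n+1]`)
(cell `pub-zeta5`, certifier 2, generation 2)

HONEST FRAMING: systematic search; no irrationality claim unless certified.

OUR work (Summit side). `Certificates/RecordRayCentreValue.log_centre_le` bounds the logarithm of the centre value
`Nm(x₀)/D(x₀)` of `|R_b(x+iY)|²` by antiderivative values `G_Y(t) = t log(t²+Y²) − 2t + 2Y arctan(t/Y)`. Along a ray
everything scales: `G_{yn}(τn) = 2τ·n log n + n·Γ_y(τ)` with `Γ_y(τ) = τ log(τ²+y²) − 2τ + 2y arctan(τ/y)` (`Gant_scale`).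
For the record ray `B₀ = 41n`, `B = BrecE e n` (`e ≤ 1`), any height `3n ≤ Y ≤ 3n+1` and both centre points
(`c = 41n/2 + s`, `s ∈ [0, 1/2]`) this file proves the ASYMPTOTIC FORM

  `log(Nm(x₀)/D(x₀)) ≤ −100·n log n + n·Ψ + 92·log(51n) + 40`,   `Ψ = 2Γ₃(41/2) − 2Σ_j Γ₃(τ_j)`,
  `τ = (7/2, 9/2, 11/2, 13/2, 15/2, 17/2, 19/2)` (`log_centre_record_le`),

the `n log n` coefficient `−100 = 2·41 − 4·Σ_j τ_j` being the degree `−(50n+5)` of `R_b` doubled. Numerically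
`Ψ/2 = Γ₃(20.5) − ΣΓ₃(τ_j) = −47.6797…` (to be certified with log/arctan enclosures by the successor; then
`log|W(bRecord n)| ≤ −(50n+…)log n + (12π − 47.68)n + O(log n)`, the sharp rate `−9.98`).
-/

noncomputable section

open Finset Real Set MeasureTheory intervalIntegral

namespace Summit.KontsevichZagierPeriods.Zeta5Search.RecordLine

/-! ### Scaling and perturbation of `G` -/

/-- `Γ_y(τ) = τ log(τ²+y²) − 2τ + 2y·arctan(τ/y)`. -/
def Gam (y τ : ℝ) : ℝ := τ * Real.log (τ ^ 2 + y ^ 2) - 2 * τ + 2 * y * Real.arctan (τ / y)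

/-- **Scaling**: `G_{yn}(τn) = 2τ·n·log n + n·Γ_y(τ)` (`n, y > 0`). -/
theorem Gant_scale {n y : ℝ} (hn : 0 < n) (hy : 0 < y) (τ : ℝ) :
    Gant (y * n) (τ * n) = 2 * τ * n * Real.log n + n * Gam y τ := by
  unfold Gant Gam
  have h1 : (τ * n) ^ 2 + (y * n) ^ 2 = n ^ 2 * (τ ^ 2 + y ^ 2) := by ring
  have hpos : 0 < τ ^ 2 + y ^ 2 := by positivity
  rw [h1, Real.log_mul (by positivity) hpos.ne', Real.log_pow, mul_div_mul_right _ _ hn.ne']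
  push_cast
  ring

/-- `g_Y(u) ≤ 2·log(51n)` for `|u| ≤ 50n`, `0 < Y ≤ 4n`, `n ≥ 1` (crude size of the stray logarithms). -/
theorem gl_le_crude {n Y u : ℝ} (hn : 1 ≤ n) (hY0 : 0 < Y) (hY : Y ≤ 4 * n) (hu : |u| ≤ 50 * n) :
    gl Y u ≤ 2 * Real.log (51 * n) := by
  unfold gl
  have h2 : 2 * Real.log (51 * n) = Real.log ((51 * n) ^ 2) := by rw [Real.log_pow]; norm_num
  rw [h2]
  apply Real.log_le_log (by positivity)
  have hu2 : u ^ 2 ≤ (50 * n) ^ 2 := by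
    rw [← sq_abs]; exact pow_le_pow_left₀ (abs_nonneg u) hu 2
  nlinarith

/-- Increments of `G`: `G(b) − G(a) ≤ (b − a)·g(M)` whenever `a ≤ b` and `|x| ≤ M` on `[a,b]` (`Y ≠ 0`). -/
theorem Gant_sub_le {Y a b M : ℝ} (hY : Y ≠ 0) (hab : a ≤ b) (hM : ∀ x ∈ Icc a b, |x| ≤ M) :
    Gant Y b - Gant Y a ≤ (b - a) * gl Y M := by
  rw [← integral_gl hY a b]
  have hci : IntervalIntegrable (fun _ : ℝ => gl Y M) volume a b :=
    (continuous_const (y := gl Y M)).intervalIntegrable a b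
  have h := intervalIntegral.integral_mono_on hab ((continuous_gl Y hY).intervalIntegrable a b) hci
    (fun x hx => ?_)
  · rw [intervalIntegral.integral_const, smul_eq_mul] at h
    linarith
  · have := hM x hx
    rw [← gl_neg] at *
    rcases le_or_gt 0 x with h0 | h0
    · rw [gl_neg]; exact gl_mono h0 (by rw [abs_of_nonneg h0] at this; exact this) hY
    · rw [gl_neg, ← gl_neg]
      exact gl_mono (by linarith) (by rw [abs_of_neg h0] at this; exact this) hY

/-- `G_Y(t)` is monotone in `Y` for `t ≥ 0`: `0 < Y ≤ Y' ⇒ G_Y(t) ≤ G_{Y'}(t)`. -/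
theorem Gant_mono_Y {Y Y' t : ℝ} (hY : 0 < Y) (hYY : Y ≤ Y') (ht : 0 ≤ t) : Gant Y t ≤ Gant Y' t := by
  have hY' : 0 < Y' := lt_of_lt_of_le hY hYY
  have e1 : Gant Y t = ∫ u in (0 : ℝ)..t, gl Y u := by rw [integral_gl hY.ne', Gant_zero, sub_zero]
  have e2 : Gant Y' t = ∫ u in (0 : ℝ)..t, gl Y' u := by rw [integral_gl hY'.ne', Gant_zero, sub_zero]
  rw [e1, e2]
  apply intervalIntegral.integral_mono_on ht ((continuous_gl Y hY.ne').intervalIntegrable _ _)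
    ((continuous_gl Y' hY'.ne').intervalIntegrable _ _)
  intro u _
  unfold gl
  apply Real.log_le_log (by positivity)
  nlinarith

/-- `G_{Y'}(t) ≤ G_Y(t) + t·(Y'²−Y²)/Y²` for `0 < Y ≤ Y'`, `t ≥ 0`
(the integrands differ by `log(1 + (Y'²−Y²)/(u²+Y²)) ≤ (Y'²−Y²)/Y²`). -/
theorem Gant_le_Gant_add {Y Y' t : ℝ} (hY : 0 < Y) (hYY : Y ≤ Y') (ht : 0 ≤ t) :
    Gant Y' t ≤ Gant Y t + t * ((Y' ^ 2 - Y ^ 2) / Y ^ 2) := by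
  have hY' : 0 < Y' := lt_of_lt_of_le hY hYY
  have e1 : Gant Y t = ∫ u in (0 : ℝ)..t, gl Y u := by rw [integral_gl hY.ne', Gant_zero, sub_zero]
  have e2 : Gant Y' t = ∫ u in (0 : ℝ)..t, gl Y' u := by rw [integral_gl hY'.ne', Gant_zero, sub_zero]
  have e3 : t * ((Y' ^ 2 - Y ^ 2) / Y ^ 2) = ∫ _ in (0 : ℝ)..t, ((Y' ^ 2 - Y ^ 2) / Y ^ 2) := by
    rw [intervalIntegral.integral_const, smul_eq_mul, sub_zero]
  have hci : IntervalIntegrable (fun _ : ℝ => (Y' ^ 2 - Y ^ 2) / Y ^ 2) volume 0 t :=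
    (continuous_const (y := (Y' ^ 2 - Y ^ 2) / Y ^ 2)).intervalIntegrable 0 t
  rw [e1, e2, e3, ← intervalIntegral.integral_add ((continuous_gl Y hY.ne').intervalIntegrable _ _) hci]
  apply intervalIntegral.integral_mono_on ht ((continuous_gl Y' hY'.ne').intervalIntegrable _ _)
    (((continuous_gl Y hY.ne').intervalIntegrable _ _).add hci)
  intro u _
  unfold gl
  have hq : 0 < u ^ 2 + Y ^ 2 := by positivity
  have hq' : 0 < u ^ 2 + Y' ^ 2 := by positivity
  have hlog : Real.log (u ^ 2 + Y' ^ 2) - Real.log (u ^ 2 + Y ^ 2) ≤ (u ^ 2 + Y' ^ 2) / (u ^ 2 + Y ^ 2) - 1 := by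
    rw [← Real.log_div hq'.ne' hq.ne']
    exact Real.log_le_sub_one_of_pos (by positivity)
  have hfrac : (u ^ 2 + Y' ^ 2) / (u ^ 2 + Y ^ 2) - 1 ≤ (Y' ^ 2 - Y ^ 2) / Y ^ 2 := by
    rw [div_sub_one hq.ne', div_le_div_iff₀ hq (by positivity)]
    have h1 : Y ^ 2 ≤ Y' ^ 2 := by nlinarith
    nlinarith [sq_nonneg u]
  linarith

/-! ### The record ray: asymptotic form of the centre value -/

/-- The reduced window half-widths `τ_j = (41 − 2β_j)/2 = (7, 9, 11, 13, 15, 17, 19)/2` (`β = 17, …, 11`). -/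
def tauRec (j : ℕ) : ℝ := ((7 + 2 * j : ℕ) : ℝ) / 2

/-- The linear-in-`n` coefficient `Ψ = 2Γ₃(41/2) − 2Σ_j Γ₃(τ_j)` (numerically `−95.36`). -/
def PsiRec : ℝ := 2 * Gam 3 (41 / 2) - 2 * ∑ j ∈ range 7, Gam 3 (tauRec j)

set_option maxHeartbeats 1600000 in
/-- **ASYMPTOTIC FORM OF THE CENTRE VALUE (record ray and partner, heights `3n ≤ Y ≤ 3n+1`).** For `e ≤ 1`, `n ≥ 1`,
`0 ≤ s ≤ 1/2` and `c = 41n/2 + s` (centre points `x₀ = −1 − c`):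
`log(Nm(x₀)/D(x₀)) ≤ −100·n·log n + n·Ψ + 92·log(51n) + 40`. -/
theorem log_centre_record_le {e n : ℕ} (he : e ≤ 1) (hn : 1 ≤ n) {Y : ℝ} (hY1 : 3 * (n : ℝ) ≤ Y)
    (hY2 : Y ≤ 3 * n + 1) {s : ℝ} (hs0 : 0 ≤ s) (hs1 : s ≤ 1 / 2) :
    Real.log (Nm (41 * n) Y (-1 - (41 * (n : ℝ) / 2 + s)) / Dx (41 * n) (BrecE e n) Y (-1 - (41 * (n : ℝ) / 2 + s)))
      ≤ -100 * n * Real.log n + n * PsiRec + 92 * Real.log (51 * n) + 40 := by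
  have hnR : (1 : ℝ) ≤ n := by exact_mod_cast hn
  have hn0 : (0 : ℝ) < n := by linarith
  have hYpos : 0 < Y := by linarith
  have hYge1 : 1 ≤ Y := by linarith
  have hY4 : Y ≤ 4 * n := by linarith
  have h3n : (0 : ℝ) < 3 * n := by linarith
  set c : ℝ := 41 * (n : ℝ) / 2 + s with hc
  -- the structural bound
  have hB : ∀ j ∈ range 7, 2 * BrecE e n j + 5 ≤ 41 * n := by
    intro j hj
    have := mem_range.1 hj
    unfold BrecE
    split_ifs with h6
    · subst h6; omega
    · have : 17 - j ≤ 17 := Nat.sub_le _ _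
      have : (17 - j) * n ≤ 17 * n := Nat.mul_le_mul_right _ this
      omega
  have hmain := log_centre_le (41 * n) (BrecE e n) hB hYge1 (c := c)
    (by rw [hc]; push_cast; linarith) (by rw [hc]; push_cast; linarith)
  -- the stray logarithms
  have hlog51 : 0 ≤ Real.log (51 * n) := Real.log_nonneg (by linarith)
  have g_half : gl Y (1 / 2) ≤ 2 * Real.log (51 * n) :=
    gl_le_crude hnR hYpos hY4 (by rw [abs_of_nonneg (by norm_num)]; linarith)
  have g_c : gl Y c ≤ 2 * Real.log (51 * n) :=
    gl_le_crude hnR hYpos hY4 (by rw [hc, abs_of_nonneg (by positivity)]; linarith)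
  have g_1 : gl Y 1 ≤ 2 * Real.log (51 * n) :=
    gl_le_crude hnR hYpos hY4 (by rw [abs_of_nonneg (by norm_num)]; linarith)
  have G_1 : Gant Y 1 ≤ 2 * Real.log (51 * n) := by
    have h := Gant_sub_le (Y := Y) (a := 0) (b := 1) (M := 1) hYpos.ne' (by norm_num)
      (fun x hx => by rw [abs_le]; constructor <;> linarith [hx.1, hx.2])
    rw [Gant_zero] at h
    linarith
  have G_1_nonneg : 0 ≤ Gant Y 1 := by rw [← Gant_zero Y]; exact Gant_mono hYge1 (by norm_num)
  have hlog4 : Real.log 4 ≤ 2 := by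
    have := Real.log_le_sub_one_of_pos (show (0:ℝ) < 4 by norm_num)
    have h2 : Real.log 4 = 2 * Real.log 2 := by
      rw [show (4:ℝ) = 2 ^ 2 by norm_num, Real.log_pow]; norm_num
    have := Real.log_two_lt_d9
    linarith
  -- scaling at height 3n
  have hscale : ∀ τ : ℝ, Gant (3 * n) (τ * n) = 2 * τ * n * Real.log n + n * Gam 3 τ := fun τ => by
    have := Gant_scale hn0 (by norm_num : (0:ℝ) < 3) τ
    rw [show (3 : ℝ) * n = 3 * n by ring] at this
    exact this
  -- the two big positive terms: `G_Y(c)` and `G_Y(41n+1−c)`, both `≤ G_{3n}(41n/2) + (1)·g + 17`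
  have hbigY : ∀ t : ℝ, 0 ≤ t → t ≤ 41 * n / 2 + 1 →
      Gant Y t ≤ n * Gam 3 (41 / 2) + 41 * n * Real.log n + 2 * Real.log (51 * n) + 17 := by
    intro t ht0 ht1
    -- Y → 3n
    have h1 := Gant_le_Gant_add h3n hY1 ht0
    have hcorr : t * ((Y ^ 2 - (3 * n) ^ 2) / (3 * n) ^ 2) ≤ 17 := by
      have hnum : Y ^ 2 - (3 * (n : ℝ)) ^ 2 ≤ 6 * n + 1 := by nlinarith
      have hden : (0 : ℝ) < (3 * n) ^ 2 := by positivity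
      calc t * ((Y ^ 2 - (3 * n) ^ 2) / (3 * n) ^ 2) ≤ (41 * n / 2 + 1) * ((6 * n + 1) / (3 * n) ^ 2) := by
            apply mul_le_mul ht1 _ (by apply div_nonneg; nlinarith; positivity) (by positivity)
            exact div_le_div_of_nonneg_right hnum hden.le
        _ ≤ 17 := by
            rw [← sub_nonneg]
            have : (41 * (n : ℝ) / 2 + 1) * ((6 * n + 1) / (3 * n) ^ 2) = (41 * n / 2 + 1) * (6 * n + 1) / (9 * n ^ 2) := by
              ring
            rw [this, sub_nonneg, div_le_iff₀ (by positivity)]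
            nlinarith
    -- t → 41n/2, at height 3n
    have h2 : Gant (3 * n) t ≤ Gant (3 * n) (41 / 2 * n) + 1 * gl (3 * n) (41 * n / 2 + 1) := by
      rcases le_or_gt t (41 / 2 * n) with hle | hgt
      · have := Gant_mono (Y := 3 * n) (by linarith) hle
        have hg : 0 ≤ gl (3 * n) (41 * n / 2 + 1) := gl_nonneg (by linarith) _
        linarith
      · have := Gant_sub_le (Y := 3 * n) (a := 41 / 2 * n) (b := t) (M := 41 * n / 2 + 1) h3n.ne' hgt.le
          (fun x hx => by rw [abs_of_nonneg (by linarith [hx.1])]; linarith [hx.2])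
        have hg : 0 ≤ gl (3 * n) (41 * n / 2 + 1) := gl_nonneg (by linarith) _
        nlinarith
    have h3 : gl (3 * n) (41 * n / 2 + 1) ≤ 2 * Real.log (51 * n) :=
      gl_le_crude hnR h3n (by linarith) (by rw [abs_of_nonneg (by positivity)]; linarith)
    have h4 := hscale (41 / 2)
    rw [show (41 / 2 : ℝ) * n = 41 / 2 * n by ring] at h4
    nlinarith
  -- the window terms: lower bounds `G_Y(c − B_j), G_Y(41n − B_j − c) ≥ n Γ₃(τ_j) + 2τ_j n log n − 3·g`
  have hwin : ∀ j ∈ range 7, ∀ t : ℝ, tauRec j * n - 3 / 2 ≤ t →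
      n * Gam 3 (tauRec j) + 2 * tauRec j * n * Real.log n - 4 * Real.log (51 * n) ≤ Gant Y t := by
    intro j hj t ht
    have hj7 := mem_range.1 hj
    have hjR : (j : ℝ) ≤ 6 := by exact_mod_cast (by omega : j ≤ 6)
    have hj0 : (0 : ℝ) ≤ j := Nat.cast_nonneg j
    have hτ : (7 : ℝ) / 2 ≤ tauRec j ∧ tauRec j ≤ 19 / 2 := by
      unfold tauRec; push_cast; constructor <;> linarith
    have ht0 : 0 ≤ t := by nlinarith
    -- Y → 3n (monotone in Y, t ≥ 0)
    have h1 : Gant (3 * n) t ≤ Gant Y t := Gant_mono_Y h3n hY1 ht0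
    -- t → τ_j n
    have h2 : Gant (3 * n) (tauRec j * n) - 3 / 2 * gl (3 * n) (tauRec j * n) ≤ Gant (3 * n) t := by
      rcases le_or_gt (tauRec j * n) t with hle | hgt
      · have := Gant_mono (Y := 3 * n) (by linarith) hle
        have hg : 0 ≤ gl (3 * n) (tauRec j * n) := gl_nonneg (by linarith) _
        linarith
      · have := Gant_sub_le (Y := 3 * n) (a := t) (b := tauRec j * n) (M := tauRec j * n) h3n.ne' hgt.le
          (fun x hx => by rw [abs_of_nonneg (by linarith [hx.1])]; exact hx.2)
        have hg : 0 ≤ gl (3 * n) (tauRec j * n) := gl_nonneg (by linarith) _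
        nlinarith
    have h3 : gl (3 * n) (tauRec j * n) ≤ 2 * Real.log (51 * n) :=
      gl_le_crude hnR h3n (by linarith) (by rw [abs_of_nonneg (by nlinarith)]; nlinarith)
    have h4 := hscale (tauRec j)
    nlinarith
  -- the window arguments are large enough
  have hargs : ∀ j ∈ range 7, tauRec j * n - 3 / 2 ≤ c - (BrecE e n j : ℝ) ∧
      tauRec j * n - 3 / 2 ≤ (41 * n : ℕ) - (BrecE e n j : ℝ) - c := by
    intro j hj
    have hj7 := mem_range.1 hj
    have hBjN : BrecE e n j ≤ (17 - j) * n + 1 := by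
      unfold BrecE; split_ifs <;> omega
    have hBj : (BrecE e n j : ℝ) ≤ (17 - (j : ℝ)) * n + 1 := by
      have h17 : ((17 - j : ℕ) : ℝ) = 17 - (j : ℝ) := by rw [Nat.cast_sub (by omega)]; norm_num
      have := (Nat.cast_le (α := ℝ)).2 hBjN
      push_cast at this
      rw [h17] at this
      exact this
    have hτj : tauRec j * n = (7 / 2 + j) * n := by unfold tauRec; push_cast; ring
    rw [hτj, hc]
    push_cast
    constructor <;> nlinarith
  -- assemble
  have hsum : ∑ j ∈ range 7, (Gant Y (c - BrecE e n j) + Gant Y ((41 * n : ℕ) - BrecE e n j - c) - 2 * Gant Y 1) ≥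
      ∑ j ∈ range 7, (2 * (n * Gam 3 (tauRec j) + 2 * tauRec j * n * Real.log n) - 12 * Real.log (51 * n)) := by
    apply sum_le_sum
    intro j hj
    obtain ⟨ha1, ha2⟩ := hargs j hj
    have w1 := hwin j hj _ ha1
    have w2 := hwin j hj _ ha2
    linarith
  have hτsum : ∑ j ∈ range 7, (2 * (n * Gam 3 (tauRec j) + 2 * tauRec j * n * Real.log n) - 12 * Real.log (51 * n))
      = 2 * n * (∑ j ∈ range 7, Gam 3 (tauRec j)) + 182 * n * Real.log n - 84 * Real.log (51 * n) := by
    rw [mul_sum]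
    simp only [sum_range_succ, sum_range_zero, tauRec]
    push_cast
    ring
  have hc0 : 0 ≤ c := by rw [hc]; positivity
  have hc1 : c ≤ 41 * n / 2 + 1 := by rw [hc]; linarith
  have hpos1 := hbigY c hc0 hc1
  have hpos2 := hbigY ((41 * n : ℕ) + 1 - c) (by rw [hc]; push_cast; linarith) (by rw [hc]; push_cast; linarith)
  have hΨ : n * PsiRec = 2 * (n * Gam 3 (41 / 2)) - 2 * n * ∑ j ∈ range 7, Gam 3 (tauRec j) := by
    unfold PsiRec; ring
  have hlogn : 0 ≤ Real.log n := Real.log_nonneg hnR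
  rw [hΨ]
  push_cast at hmain hpos2 hsum ⊢
  linarith [hsum, hτsum.le, hτsum.ge]

end Summit.KontsevichZagierPeriods.Zeta5Search.RecordLine
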